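import Summits.BirchSwinnertonDyer.Rank1Residual.X2.TrivialZeroCorankAlgebra
import Summits.BirchSwinnertonDyer.Rank1Residual.X2.TrivialZeroQuotient
import HarnessLib

/-!
# `#(S^{Σ₀}_{E[p^∞]}(ℚ_∞) ⊓ H¹[p]) = p^{λ(E) + Σ_{ℓ∈Σ₀} δ_E^{(ℓ)} + 1}` at an odd SPLIT multiplicative
# prime `p ‖ N` — the trivial zero `e_p = 1` of route G, from printed GV statements

HONEST FRAMING (cell `b2b-bsdres`, run/shared/lean/b2b/bsd-rank1-residual/, verbatim in every
file): the goal of the cell is to DELETE the COMBINATION-SHAPED residual classes of the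
Birch–Swinnerton-Dyer formula for ALL analytic-rank `≤ 1` elliptic curves over `ℚ` — "full BSD
formula for every rank `≤ 1` curve in class `C`" assembled STRICTLY from published theorems — so
that the rank-`≤ 1` remainder becomes exactly the CONSTRUCTION-SHAPED classes, which are TYPED
(missing-input `Prop`s), NOT attempted. This is not "finishing BSD". Sub-cell
`b2b-bsdres-eisenstein-p2` (CLASS-OWNERS row "X2"), gen 13: research route; NO CLAIM BEYOND STATED
CLASSES; nothing here changes a label. Theorems only; axioms standard; no `sorry`.

WHAT THIS FILE PROVES (step K-C2 of the `p ‖ N` Λ-bookkeeping for route G; X2-GAP §12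
"`Λ = λ_alg + e_p`, `e_p = 1` at a split prime", §17.4 (ii)). For `E/ℚ` globally minimal, `p` ODD with
`p ‖ N` SPLIT, `κ` cyclotomic with topological generator `γ`, `Σ₀ ∌ p` finite with every
`v ∉ Σ₀ ∪ {p}` good, `μ(E) = 0` (f.g. torsion dual datum `D` with `D.mu = 0`):
**`exists_data_natCard_gvSelmerInfty_inf_torsion_eq_pow_of_split`** — for the Tate data `L` above
`p` (GV's `htriv`, `hgen`): `#(S^{Σ₀}_{E[p^∞]}(ℚ_∞) ⊓ H¹[p]) = p^{λ(D.X) + Σ_{v∈Σ₀} δ_E^{(v)} + 1}`.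
Chain (the "`+1`" is the trivial zero): `T := Sel^{Σ₀} = S^{Σ₀,str} ≤ S := S^{Σ₀}` (gen 12);
`corank T = λ + Σδ`, `T[p]` finite (K-A, GV (5)–(7) at `p ‖ N`); `S/T ↪ D = E[p^∞]/C ≅ ℚ_p/ℤ_p`
(K-C1) with `#D[p] = p` (`C` cofree of corank one, K-B1), NONZERO (GV p. 15 = fact
`datumStrictSelmer_lt_datumSelmer_of_split`); `S` divisible (GV Prop. (2.5)/p. 25 = fact
`datumSelmer_divisible_of_finite_torsionBy`); hence the image `R` of `S` in `D` is a nonzero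
divisible subgroup with `#R[p] = p`, `corank R = 1`, `corank S = corank T + 1`
(`zpCorank_eq_add_of_shortExact`) and `#S[p] = p^{corank S}`.
Inputs that are NOT tree theorems: A40 (Tate uniformisation, split), GV (5)–(7) at `p ‖ N` (`hA`),
GV Prop. (2.5)/p. 25 (`hB`), GV p. 15 (`hF`); Kato's cotorsion as the hypothesis `D.IsTorsion`.

References: Greenberg–Vatsal 2000 §1 (5)–(7), §2 pp. 14–16, Prop. (2.1), (2.5), pp. 20, 25–26;
Silverman *ATAEC* V.3, V.5.
-/

noncomputable section

open scoped Classical AddSubgroup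

universe u

namespace Summit.BirchSwinnertonDyer.Rank1Residual.X2.GreenbergSelmerCountSplit

open NumberField IsDedekindDomain Field Literature.NumberTheory.GaloisRepresentations
  Literature.NumberTheory.EllipticCurves Literature.NumberTheory.EllipticCurves.GreenbergSelmer
  Literature.NumberTheory.EllipticCurves.GreenbergVatsal2000 IsDedekindDomain.HeightOneSpectrum
  Summit.BirchSwinnertonDyer.Rank1Residual.X2.GreenbergVatsalTorsion
  Summit.BirchSwinnertonDyer.Rank1Residual.X2.GreenbergVatsalStrictSelmer
  Summit.BirchSwinnertonDyer.Rank1Residual.X2.GreenbergVatsalTateDatum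
  Summit.BirchSwinnertonDyer.Rank1Residual.X2.GreenbergVatsalTateDatumSign
  Summit.BirchSwinnertonDyer.Rank1Residual.X2.GreenbergVatsalTateDatumTorsion
  Summit.BirchSwinnertonDyer.Rank1Residual.X2.NonPrimitiveSelmerStrictEquality
  Summit.BirchSwinnertonDyer.Rank1Residual.X2.GreenbergVatsalStrictSelmerMultiplicative
  Summit.BirchSwinnertonDyer.Rank1Residual.X2.GreenbergVatsalTateDatumCofree
  Summit.BirchSwinnertonDyer.Rank1Residual.X2.NonPrimitiveSelmerCorank
  Summit.BirchSwinnertonDyer.Rank1Residual.X2.GreenbergSelmerCountNonsplit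
  Summit.BirchSwinnertonDyer.Rank1Residual.X2.TrivialZeroQuotient
  Summit.BirchSwinnertonDyer.Rank1Residual.X2.TrivialZeroCorankAlgebra

/-! ## §3. The split count -/

section Split

variable (W : WeierstrassCurve ℚ) [W.IsGloballyMinimal] [W.IsElliptic] (p : ℕ) [hp : Fact p.Prime]
  (κ : ZpExtension ℚ p) {γ : absoluteGaloisGroup ℚ} (S₀ : Finset (HeightOneSpectrum (𝓞 ℚ)))

omit [W.IsGloballyMinimal] [W.IsElliptic] in
/-- `S_A = S^{∅} ≤ S^{Σ₀}` (GV p. 20 "Obviously, `S_A(ℚ_∞) ⊆ S^{Σ₀}_A(ℚ_∞)`").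
[cite: GreenbergVatsal2000, §2 p. 20] -/
theorem gvSelmerInfty_empty_le (L : Data ℚ (W.geomPrimaryTorsion p) p)
    (S₁ : Set (HeightOneSpectrum (𝓞 ℚ))) :
    gvSelmerInfty κ (W.geomPrimaryTorsion p) L ∅ ≤ gvSelmerInfty κ (W.geomPrimaryTorsion p) L S₁ := by
  intro c hc
  rw [gvSelmerInfty, mem_gvSelmer_iff] at hc ⊢
  exact ⟨fun v _ hpv σ ↦ hc.1 v (Set.notMem_empty v) hpv σ, hc.2⟩

omit [W.IsGloballyMinimal] in
/-- `E(ℚ_∞)[p^∞]` is finite at an odd SPLIT `p ‖ N` (cyclotomic `κ`), from the untwisted Tate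
uniformisation A40 (twin of gen 9's `finite_fixedPoints_kerSubgroup_of_hasMultiplicativeReductionAtPrime`,
which takes A41). GV p. 26 "`E(ℚ_∞)_{tors}` is known to be finite".
[cite: GreenbergLNM1716, §1 p. 62; §3 p. 86] [cite: GreenbergVatsal2000, §2 p. 26] -/
theorem finite_fixedPoints_kerSubgroup_of_split (hT : Silverman1994_thmV53_tateUniformisation.{0})
    (hp2 : p ≠ 2) (hsplit : W.HasSplitMultiplicativeReductionAtPrime p) (hκ : κ.IsCyclotomic) :
    Finite (FixedPoints.addSubgroup κ.kerSubgroup (W.geomPrimaryTorsion p)) := by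
  set v : HeightOneSpectrum (𝓞 ℚ) := (Rat.HeightOneSpectrum.primesEquiv (R := 𝓞 ℚ)).symm ⟨p, hp.out⟩
    with hvdef
  have hv : ((p : ℕ) : 𝓞 ℚ) ∈ v.asIdeal :=
    (natCast_mem_asIdeal_iff_eq_primesEquiv_symm v hp.out).mpr hvdef
  obtain ⟨q, Φ, hq0, hq1, hsurj, hker, hΦσ, -⟩ :=
    hT W v (hasSplitMultiplicativeReductionAt_of_mem W p hsplit hv)
  exact finite_fixedPoints_kerSubgroup W p Φ (sign_disj W Φ 0 (sign_of_equivariant W Φ hΦσ)) hq0 hq1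
    (fun u h ↦ (hker u).1 h) (fun σ _ u ↦ hΦσ σ u) κ hκ hp2 hv hsurj

/-- **`#(S^{Σ₀}_{E[p^∞]}(ℚ_∞) ⊓ H¹[p]) = p^{λ(E) + Σ_{v∈Σ₀} δ_E^{(v)} + 1}` at an odd SPLIT `p ‖ N`**
(`E/ℚ` globally minimal, `κ` cyclotomic with topological generator `γ`, `Σ₀ ∌ p` finite with every
`v ∉ Σ₀ ∪ {p}` good, `D` a f.g. `Λ`-torsion dual datum of `Sel_{p^∞}(E/ℚ_∞)` with `μ = 0`), for the
Tate data `L` above `p` (with GV's `htriv`, `hgen`): the trivial zero contributes EXACTLY `p^1`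
(`e_p = 1`). Inputs: A40 (`hT`), GV (5)–(7) at `p ‖ N` (`hA`), GV Prop. (2.5)/p. 25 (`hB`), GV p. 15
(`hF`). [cite: GreenbergVatsal2000, §1 (5)–(7) pp. 7–8, p. 15; §2 Prop. (2.1), (2.5), pp. 20, 25]
[cite: SilvermanATAEC1994, Ch. V Thm. 3.1 (c),(d) p. 423 and §V.5 Thm. 5.3 (a),(b)] -/
theorem exists_data_natCard_gvSelmerInfty_inf_torsion_eq_pow_of_split
    (hT : Silverman1994_thmV53_tateUniformisation.{0})
    (hA : lambda_nonPrimitive_eq_add_sum_delta_multiplicative)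
    (hB : datumSelmer_divisible_of_finite_torsionBy)
    (hF : datumStrictSelmer_lt_datumSelmer_of_split)
    (hκ : κ.IsCyclotomic) (hγ : κ.IsTopGenerator γ) (hp2 : p ≠ 2)
    (hsplit : W.HasSplitMultiplicativeReductionAtPrime p)
    (hS₀ : ∀ v ∈ S₀, ((p : ℕ) : 𝓞 ℚ) ∉ v.asIdeal)
    (hS : ∀ v : HeightOneSpectrum (𝓞 ℚ), v ∉ S₀ → ((p : ℕ) : 𝓞 ℚ) ∉ v.asIdeal →
      W.HasGoodReductionAt v)
    (D : W.SelmerDualData κ γ) [Module.Finite (IwasawaAlgebra p) D.X] (hX : D.IsTorsion)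
    (hμ : D.mu = 0) :
    ∃ L : Data ℚ (W.geomPrimaryTorsion p) p,
      (∀ (v : HeightOneSpectrum (𝓞 ℚ)) (hv : ((p : ℕ) : 𝓞 ℚ) ∈ v.asIdeal),
        ∀ x ∈ inertia v, ∀ m : W.geomPrimaryTorsion p, x • m - m ∈ (L v hv).plus) ∧
      (∀ (v : HeightOneSpectrum (𝓞 ℚ)) (hv : ((p : ℕ) : 𝓞 ℚ) ∈ v.asIdeal),
        ∀ c ∈ (torsionData L p v hv).plus, ∃ τ ∈ inertia v,
          ∃ c' ∈ (torsionData L p v hv).plus, τ • c' - c' = c) ∧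
      nonPrimitiveSelmerInfty W κ (↑S₀ : Set (HeightOneSpectrum (𝓞 ℚ))) =
        gvStrictSelmerInfty κ (W.geomPrimaryTorsion p) L (↑S₀ : Set (HeightOneSpectrum (𝓞 ℚ))) ∧
      Nat.card ↥(gvSelmerInfty κ (W.geomPrimaryTorsion p) L (↑S₀ : Set (HeightOneSpectrum (𝓞 ℚ))) ⊓
          (subgroupH1 κ.kerSubgroup (W.geomPrimaryTorsion p))[(p : ℤ)]) =
        p ^ (lambdaInvariant p D.X + ∑ v ∈ S₀, delta W p v + 1) := by
  have hmult : W.HasMultiplicativeReductionAtPrime p := hsplit.hasMultiplicativeReductionAtPrime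
  obtain ⟨L, htriv, hgen, hC, htrivD, hle, hge⟩ := exists_data_of_split W p κ hT hp2 hsplit
  -- the place above `p`
  set v₀ : HeightOneSpectrum (𝓞 ℚ) := (Rat.HeightOneSpectrum.primesEquiv (R := 𝓞 ℚ)).symm ⟨p, hp.out⟩
    with hv₀def
  have hv₀ : ((p : ℕ) : 𝓞 ℚ) ∈ v₀.asIdeal :=
    (natCast_mem_asIdeal_iff_eq_primesEquiv_symm v₀ hp.out).mpr hv₀def
  have hS₀'' : ∀ v ∈ (↑S₀ : Set (HeightOneSpectrum (𝓞 ℚ))), ((p : ℕ) : 𝓞 ℚ) ∉ v.asIdeal :=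
    fun v hv ↦ hS₀ v (Finset.mem_coe.1 hv)
  have hS' : ∀ v : HeightOneSpectrum (𝓞 ℚ), v ∉ (↑S₀ : Set (HeightOneSpectrum (𝓞 ℚ))) →
      ((p : ℕ) : 𝓞 ℚ) ∉ v.asIdeal → W.HasGoodReductionAt v :=
    fun v hv hpv ↦ hS v (fun h ↦ hv (Finset.mem_coe.2 h)) hpv
  -- `T := Sel^{Σ₀} = S^{Σ₀,str} ≤ S := S^{Σ₀}`
  have heqT : nonPrimitiveSelmerInfty W κ (↑S₀ : Set (HeightOneSpectrum (𝓞 ℚ))) =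
      gvStrictSelmerInfty κ (W.geomPrimaryTorsion p) L ↑S₀ :=
    nonPrimitiveSelmerInfty_eq_gvStrictSelmerInfty_of_le W p κ L _ hp2 hκ hS₀'' hS' hle hge
  have hTS : nonPrimitiveSelmerInfty W κ (↑S₀ : Set (HeightOneSpectrum (𝓞 ℚ))) ≤
      gvSelmerInfty κ (W.geomPrimaryTorsion p) L ↑S₀ :=
    heqT.le.trans (gvStrictSelmerInfty_le_gvSelmerInfty κ _ L _)
  -- (a) corank and finiteness of `T[p]`
  obtain ⟨hfinT, hcorkT⟩ :=
    finite_torsionBy_and_zpCorank_nonPrimitiveSelmerInfty_eq_multiplicative W S₀ hA hp2 hmult hκ hγ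
      hS₀ D hX hμ
  haveI := hfinT
  -- (b) the trivial-zero map `Φ : S → D` with kernel `T`
  obtain ⟨Φ, hΦ⟩ := exists_trivialZeroHom W p κ L htrivD (↑S₀ : Set (HeightOneSpectrum (𝓞 ℚ))) hκ hv₀
  have hΦT : ∀ c : ↥(gvSelmerInfty κ (W.geomPrimaryTorsion p) L ↑S₀),
      Φ c = 0 ↔ (c : W.subgroupH1 p κ.kerSubgroup) ∈
        nonPrimitiveSelmerInfty W κ (↑S₀ : Set (HeightOneSpectrum (𝓞 ℚ))) := fun c ↦ by
    rw [hΦ c, heqT]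
  -- (c) `D[p]` finite of order `p`
  obtain ⟨hfinGr, hcardGr⟩ :=
    finite_and_natCard_torsionBy_gr W p (L v₀ hv₀) (hC v₀ hv₀).1 (hC v₀ hv₀).2
  haveI := hfinGr
  -- (d) `S[p]` finite (kernel `↪ T[p]`, target `D[p]`)
  haveI hfinS : Finite ((↥(gvSelmerInfty κ (W.geomPrimaryTorsion p) L ↑S₀))[(p : ℤ)]) :=
    finite_torsionBy_of_hom Φ hΦT
  have hfinS' : Finite ↥(gvSelmerInfty κ (W.geomPrimaryTorsion p) L ↑S₀ ⊓
      (subgroupH1 κ.kerSubgroup (W.geomPrimaryTorsion p))[(p : ℤ)]) :=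
    (finite_inf_torsionBy_iff _ _).2 hfinS
  -- (e) `S` divisible (GV Prop. (2.5) / p. 25)
  have hdiv : ∀ s : ↥(gvSelmerInfty κ (W.geomPrimaryTorsion p) L ↑S₀),
      ∃ t : ↥(gvSelmerInfty κ (W.geomPrimaryTorsion p) L ↑S₀), p • t = s := by
    intro s
    obtain ⟨t, ht, hts⟩ := hB W p hp2 κ hκ L hC htriv S₀ hS₀ hS hfinS'
      (s : W.subgroupH1 p κ.kerSubgroup) s.2
    exact ⟨⟨t, ht⟩, Subtype.ext (by rw [AddSubgroupClass.coe_nsmul]; exact hts)⟩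
  -- (f) `Φ ≠ 0` (GV p. 15)
  haveI := hfinS'
  have hfinA : Finite ↥(gvSelmerInfty κ (W.geomPrimaryTorsion p) L ∅ ⊓
      (subgroupH1 κ.kerSubgroup (W.geomPrimaryTorsion p))[(p : ℤ)]) :=
    finite_inf_torsionBy_of_le (p : ℤ)
      (gvSelmerInfty_empty_le W p κ L (↑S₀ : Set (HeightOneSpectrum (𝓞 ℚ))))
  have hfix := finite_fixedPoints_kerSubgroup_of_split W p κ hT hp2 hsplit hκ
  obtain ⟨c₀, hc₀⟩ := exists_apply_ne_zero_of_split W p κ L (↑S₀ : Set (HeightOneSpectrum (𝓞 ℚ)))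
    hF hκ hp2 hsplit hC htriv hfinA hfix Φ hΦ
  -- (g) `corank S = corank T + corank R`, `R = Φ(S)`
  have hprimS : ∀ s : ↥(gvSelmerInfty κ (W.geomPrimaryTorsion p) L ↑S₀), ∃ n : ℕ, p ^ n • s = 0 :=
    fun s ↦ by
    obtain ⟨n, hn⟩ := W.exists_pow_smul_subgroupH1_ker_eq_zero κ (s : W.subgroupH1 p κ.kerSubgroup)
    exact ⟨n, Subtype.ext (by rw [AddSubgroupClass.coe_nsmul]; exact hn)⟩
  have hadd := zpCorank_eq_add_of_hom p hTS Φ hΦT hprimS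
  -- (h) `corank R = 1`
  have hprimR : ∀ r : ↥Φ.range, ∃ n : ℕ, p ^ n • r = 0 := fun r ↦ by
    obtain ⟨n, hn⟩ := primary_gr W p (L v₀ hv₀) (r : (L v₀ hv₀).Gr)
    exact ⟨n, Subtype.ext (by rw [AddSubgroupClass.coe_nsmul]; exact hn)⟩
  obtain ⟨hfinR, hdvd⟩ := finite_and_natCard_torsionBy_dvd_of_le (p : ℤ) Φ.range
  haveI := hfinR
  rw [hcardGr] at hdvd
  have hne : (⟨Φ c₀, ⟨c₀, rfl⟩⟩ : ↥Φ.range) ≠ 0 := fun h ↦ hc₀ (congrArg Subtype.val h)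
  have hR : zpCorank (↥Φ.range) p = 1 :=
    zpCorank_eq_one p hprimR (range_divisible p Φ hdiv) hne hdvd
  -- (i) assemble
  refine ⟨L, htriv, hgen, heqT, ?_⟩
  rw [natCard_inf_torsionBy_eq, natCard_torsionBy_eq_pow_zpCorank_of_divisible p hprimS hdiv, hadd, hR,
    hcorkT]

end Split

end Summit.BirchSwinnertonDyer.Rank1Residual.X2.GreenbergSelmerCountSplit

end
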